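import Summits.ResolutionOfSingularities.ResolutionOfSingularities.Theorems.EquisingularLiftEquisingularLiftNatSpecimenConeCharts
import Summits.ResolutionOfSingularities.ResolutionOfSingularities.Theorems.EquisingularLiftEquisingularLiftNatSpecimenHypersurfaceChartRings
import Summits.ResolutionOfSingularities.ResolutionOfSingularities.Theorems.EquisingularLiftEquisingularLiftNatLinearCentre
import Summits.ResolutionOfSingularities.ResolutionOfSingularities.Theorems.EquisingularLiftEquisingularLiftNatLinearCentreCharts
import Summits.ResolutionOfSingularities.ResolutionOfSingularities.Theorems.EquisingularLiftEquisingularLiftNatLinearCentreRung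
import HarnessLib

/-!
# [OURS · L1 W4.5(b)] COORDINATE LINEAR CENTRES ON A HYPERSURFACE, ANY DIMENSION: the centre on the charts, regularity of the
# blow-up from the chart rings, and the EL♮ rung for an arbitrary set of killed variables
# (crux `Theses.EquisingularLift.EquisingularLiftNat`, stmt-ResolutionOfSingularities-20038)

NOT a statement of any manuscript; OURS kernel plumbing (cell `res-hironaka`, chain w45b; seat res-D-pv-013, own initiative, counted 0). AI-written,
weaker than expert review. No definition, no `sorry`, standard axioms.

The chart analysis of `Cone.elNatAt_cone` (p524856, `ℙ³`, centre the vertex) and of res-D-pv-022's `…WhitneyCubicCharts` (centre a line) made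
GENERIC: any homogeneous `F ∈ k[x₀,…,x_{n+1}]` of positive degree, `H = V₊(F)`, and the coordinate linear subspace `L = V(x_a : a ∉ range e)`
for an arbitrary injective `e : Fin (r+1) → Fin (n+2)` (the SURVIVING variables; kill map `f_k`, `Λ = ker Proj(f_k)`, files
`…NatLinearCentreKill/…NatLinearCentre/…NatLinearCentreCharts`, p505223/p505964/p507578):

* `HypersurfaceSpecimen.chart_left_comp_ι`, `appLE_chart_awayToSection` — `Spec (ChartRing F c) → H ↪ ℙⁿ⁺¹` and pulled-back sections;
* **`HypersurfaceSpecimen.comap_chart_eq_ofIdealTop`** — on the chart `Spec (ChartRing F c)` the centre `Λ·𝒪_H` is the ideal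
  `(x_a/x_c : a ∉ range e)~`;
* **`HypersurfaceSpecimen.isRegular_of_isBlowup_comap_of_charts`** — if the chart rings `ChartRing F c`, `c ∉ range e` (off `L`), are regular
  and the affine blow-up algebras `(ChartRing F c)[I_c/(x_a/x_c)]`, `c ∈ range e`, `a ∉ range e`, are regular, then EVERY blow-up of `H` along
  `Λ·𝒪_H` is a regular scheme (Stacks 0804 charts at the generators; off `L` the centre is the unit ideal);
* **`elNatAt_of_linearCentreKill`** — the linear-centre rung `elNatAt_of_linearCentre` (p529556, last-`m`-variables convention, ambient
  `Fin (r + m + 1)`) re-run for an arbitrary `e` in the ambient `Fin (N + 1)` (so that `N` may be a variable: `Fin (0 + N + 1)` and `Fin (N + 1)`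
  are not definitionally equal for a variable `N`).

References: Hartshorne II Prop. 5.9 / Ex. 3.12; The Stacks Project 0804, 02IS; Görtz–Wedhorn I 13.96 — through the cited tree files.
-/

set_option linter.dupNamespace false -- mandated namespace `Summit.<Summit>.<Problem>` of this single-conjunct summit

noncomputable section

open CategoryTheory CategoryTheory.Limits AlgebraicGeometry TopologicalSpace
open MvPolynomial HomogeneousLocalization
open Literature.AlgebraicGeometry.Resolution
open Literature.AlgebraicGeometry.Motives Literature.AlgebraicGeometry.Motives.SmoothHypersurface
open Literature.AlgebraicGeometry.Motives.ProjectiveSpace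
open AlgebraicGeometry.Scheme.IdealSheafData
open Summit.ResolutionOfSingularities.ResolutionOfSingularities.Cruxes.EquisingularLift.StrataSplit

namespace Summit.ResolutionOfSingularities.ResolutionOfSingularities.Cruxes.EquisingularLiftNat.Sections

attribute [local instance] MvPolynomial.gradedAlgebra ProjBaseChange.algebraBase

namespace HypersurfaceSpecimen

variable (k : Type) [Field k] {n : ℕ} (F : MvPolynomial (Fin (n + 2)) k) {d : ℕ} (hF : F.IsHomogeneous d) (hd : 0 < d)

/-! ## The chart `Spec (ChartRing F c) → H ↪ ℙⁿ⁺¹` and pulled-back sections -/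

section Chart

variable (c : Fin (n + 2))

/-- `Spec (ChartRing F c) → V₊(F) ↪ ℙⁿ⁺¹_k` is `Spec (k[x]_{(x_c)} → ChartRing F c)` followed by `D₊(x_c) ↪ ℙⁿ⁺¹_k`
(`SmoothHypersurface.chart_hypersurfaceι` on underlying schemes; any `n`). [folklore] -/
theorem chart_left_comp_ι :
    (chart F c hF hd).left ≫ (hypersurfaceι F).left =
      Spec.map (CommRingCat.ofHom (toChartRing F c hF).toRingHom) ≫
        Proj.awayι (homogeneousSubmodule (Fin (n + 2)) k) (X c) (X_mem c) one_pos := by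
  have h := congrArg (fun f => f.left) (chart_hypersurfaceι F c hF hd)
  simp only [Over.comp_left, specOverOfAlgHom_left, awayChartι_left] at h
  exact h

/-- **Pulling a section `b` of `D₊(x_c)` back to `Spec (ChartRing F c)`** gives `[b]` (through `Γ(Spec A, ⊤) ≅ A`; any `n`). [folklore] -/
theorem appLE_chart_awayToSection
    (hle : (⊤ : (Spec (CommRingCat.of (ChartRing F c hF))).Opens) ≤
      (Spec.map (CommRingCat.ofHom (toChartRing F c hF).toRingHom) ≫
        Proj.awayι (homogeneousSubmodule (Fin (n + 2)) k) (X c) (X_mem c) one_pos) ⁻¹ᵁ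
          Proj.basicOpen (homogeneousSubmodule (Fin (n + 2)) k) (X c))
    (b : Away (homogeneousSubmodule (Fin (n + 2)) k) (X c)) :
    ((Spec.map (CommRingCat.ofHom (toChartRing F c hF).toRingHom) ≫
        Proj.awayι (homogeneousSubmodule (Fin (n + 2)) k) (X c) (X_mem c) one_pos).appLE
        (Proj.basicOpen (homogeneousSubmodule (Fin (n + 2)) k) (X c)) ⊤ hle).hom
        ((Proj.awayToSection (homogeneousSubmodule (Fin (n + 2)) k) (X c)).hom b) =
      (Scheme.ΓSpecIso (CommRingCat.of (ChartRing F c hF))).inv.hom (toChartRing F c hF b) := by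
  have happ : (Spec.map (CommRingCat.ofHom (toChartRing F c hF).toRingHom) ≫
        Proj.awayι (homogeneousSubmodule (Fin (n + 2)) k) (X c) (X_mem c) one_pos).appLE
        (Proj.basicOpen (homogeneousSubmodule (Fin (n + 2)) k) (X c)) ⊤ hle =
      (Proj.awayι (homogeneousSubmodule (Fin (n + 2)) k) (X c) (X_mem c) one_pos).appLE
          (Proj.basicOpen (homogeneousSubmodule (Fin (n + 2)) k) (X c)) ⊤
          (ProjFrac.awayι_preimage_basicOpen_self (X_mem (R := k) c) one_pos).ge ≫
        (Spec.map (CommRingCat.ofHom (toChartRing F c hF).toRingHom)).appLE ⊤ ⊤ le_rfl :=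
    (Scheme.Hom.appLE_comp_appLE _ _ _ _ _ _ _).symm
  have htop : (Spec.map (CommRingCat.ofHom (toChartRing F c hF).toRingHom)).appLE ⊤ ⊤ le_rfl =
      (Spec.map (CommRingCat.ofHom (toChartRing F c hF).toRingHom)).appTop :=
    (Scheme.Hom.app_eq_appLE _).symm
  rw [happ, ProjFrac.appLE_awayι_eq_resAway, htop, CategoryTheory.ConcreteCategory.comp_apply,
    ProjFrac.resAway_awayToSection]
  have hnat := Scheme.ΓSpecIso_inv_naturality (CommRingCat.ofHom (toChartRing F c hF).toRingHom)
  exact (congrArg (fun f => f.hom b) hnat).symm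

end Chart

/-! ## The coordinate linear centre `Λ = V(x_a : a ∉ range e)` on the charts of `H = V₊(F)` -/

section Centre

variable {r : ℕ} (e : Fin (r + 1) → Fin (n + 2)) (he : Function.Injective e)
  (fk : homogeneousSubmodule (Fin (n + 2)) k →+*ᵍ homogeneousSubmodule (Fin (r + 1)) k)
  (hfk' : HomogeneousIdeal.irrelevant (homogeneousSubmodule (Fin (r + 1)) k) ≤
    (HomogeneousIdeal.irrelevant (homogeneousSubmodule (Fin (n + 2)) k)).map fk)
  (hfkC : ∀ a : k, fk (C a) = C a) (hfke : ∀ j : Fin (r + 1), fk (X (e j)) = X j)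
  (hfk0 : ∀ i : Fin (n + 2), i ∉ Set.range e → fk (X i) = 0)

include he hfkC hfke hfk0 in
/-- **THE CENTRE ON THE CHART** (any `n`, any set of killed variables): the pull-back of `Λ = ker Proj(f_k)` along
`Spec (ChartRing F c) → H ↪ ℙⁿ⁺¹_k` is the ideal sheaf of `(x_a/x_c : a ∉ range e) ⊆ ChartRing F c` (`Limits.ideal_comap_eq_map`,
`LinearCentre.ker_projMap_kill_ideal_basicOpen` p507578, `appLE_chart_awayToSection`). [cite: Hartshorne1977, II Prop. 5.9 and Ex. 3.12 (a)] -/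
theorem comap_chart_eq_ofIdealTop (c : Fin (n + 2)) :
    (((Proj.map fk hfk').ker.comap (hypersurfaceι F).left).comap (chart F c hF hd).left :
        (Spec (CommRingCat.of (ChartRing F c hF))).IdealSheafData) =
      ofIdealTop ((Ideal.span (Set.range fun a : {a : Fin (n + 2) // a ∉ Set.range e} => tautVec F c hF a.1)).map
        (Scheme.ΓSpecIso (CommRingCat.of (ChartRing F c hF))).inv.hom) := by
  haveI : IsAffine (Comma.left (specOver k (ChartRing F c hF))) :=
    inferInstanceAs (IsAffine (Spec (CommRingCat.of (ChartRing F c hF))))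
  set π := Spec.map (CommRingCat.ofHom (toChartRing F c hF).toRingHom) ≫
    Proj.awayι (homogeneousSubmodule (Fin (n + 2)) k) (X c) (X_mem c) one_pos with hπ
  have hcomp : ((Proj.map fk hfk').ker.comap (hypersurfaceι F).left).comap (chart F c hF hd).left =
      (Proj.map fk hfk').ker.comap π := by
    rw [← Scheme.IdealSheafData.comap_comp]
    exact congrArg (fun f => (Proj.map fk hfk').ker.comap f) (chart_left_comp_ι k F hF hd c)
  refine hcomp.trans ?_
  let D : (Proj (homogeneousSubmodule (Fin (n + 2)) k)).affineOpens :=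
    ⟨Proj.basicOpen (homogeneousSubmodule (Fin (n + 2)) k) (X c),
      Proj.isAffineOpen_basicOpen _ (X c) (Segre.X_mem k c) one_pos⟩
  have hV : ((⟨⊤, isAffineOpen_top _⟩ : (Spec (CommRingCat.of (ChartRing F c hF))).affineOpens) :
      (Spec (CommRingCat.of (ChartRing F c hF))).Opens) = π ⁻¹ᵁ (D : (Proj _).Opens) := by
    change ⊤ = Spec.map _ ⁻¹ᵁ (Proj.awayι (homogeneousSubmodule (Fin (n + 2)) k) (X c) (X_mem c) one_pos ⁻¹ᵁ
      Proj.basicOpen (homogeneousSubmodule (Fin (n + 2)) k) (X c))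
    rw [ProjFrac.awayι_preimage_basicOpen_self (X_mem (R := k) c) one_pos]
    rfl
  apply Scheme.IdealSheafData.ext_of_isAffine
  rw [ideal_ofIdealTop_top, Literature.AlgebraicGeometry.Limits.ideal_comap_eq_map π _ D _ hV,
    LinearCentre.ker_projMap_kill_ideal_basicOpen e he fk hfk' hfkC hfke hfk0 c, Ideal.map_span, Ideal.map_span,
    ← Set.range_comp, ← Set.range_comp]
  refine congrArg Ideal.span (congrArg Set.range (funext fun a => ?_))
  simp only [Function.comp_apply]
  rw [appLE_chart_awayToSection]
  rfl

/-! ## Every blow-up of `H` along `Λ·𝒪_H` is regular — from the chart rings -/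

include hd he hfkC hfke hfk0 in
/-- **REGULARITY OF THE BLOW-UP OF A HYPERSURFACE ALONG A COORDINATE LINEAR SUBSPACE, FROM THE CHARTS** (any `n`, any `e`): if the chart
rings `ChartRing F c` for `c ∉ range e` (the charts off `L = V(x_a : a ∉ range e)`) are regular, and for `c ∈ range e` the affine blow-up
algebras `(ChartRing F c)[I_c/(x_a/x_c)]`, `I_c = (x_{a'}/x_c : a' ∉ range e)`, `a ∉ range e`, are regular, then every blow-up
`ρ : Z → H = V₊(F)` along `Λ·𝒪_H` is a regular scheme. Over `D₊(x_c)` the blow-up is a blow-up of `Spec (ChartRing F c)` along `Ĩ_c`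
(`comap_chart_eq_ofIdealTop`); off `L` that ideal is `(1)` (it contains `x_c/x_c`) and `ρ` is an isomorphism onto the regular chart; on `L` the
charts at the generators (Stacks 0804) are spectra of the given regular rings. [cite: StacksProject, Tag 0804] -/
theorem isRegular_of_isBlowup_comap_of_charts
    (hoff : ∀ c : Fin (n + 2), c ∉ Set.range e → IsRegularRing (ChartRing F c hF))
    (hon : ∀ c : Fin (n + 2), c ∈ Set.range e → ∀ a : {a : Fin (n + 2) // a ∉ Set.range e},
      IsRegularRing (blowupAlgebra (Ideal.span (Set.range fun a' : {a' : Fin (n + 2) // a' ∉ Set.range e} => tautVec F c hF a'.1))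
        (tautVec F c hF a.1)))
    (Z : Scheme.{0}) (ρ : Z ⟶ (hypersurface F).left) (hρ : IsBlowup ρ ((Proj.map fk hfk').ker.comap (hypersurfaceι F).left)) :
    Scheme.IsRegular Z := by
  intro z
  obtain ⟨c, hc⟩ := exists_mem_coordChartOpen ((hypersurfaceι F).left (ρ z))
  let U : (hypersurface F).left.Opens := (hypersurfaceι F).left ⁻¹ᵁ Proj.basicOpen (homogeneousSubmodule (Fin (n + 2)) k) (X c)
  have hzU : ρ z ∈ U := hc
  have hrange : Set.range (chart F c hF hd).left = Set.range U.ι := by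
    rw [range_chart_left, Scheme.Opens.range_ι]
  let ee := IsOpenImmersion.isoOfRangeEq (chart F c hF hd).left U.ι hrange
  have hee : ee.hom ≫ U.ι = (chart F c hF hd).left := IsOpenImmersion.isoOfRangeEq_hom_fac _ _ _
  -- the restricted blow-up, moved to `Spec (ChartRing F c)`
  have hρU : IsBlowup ((ρ ∣_ U) ≫ ee.symm.hom) (ofIdealTop ((Ideal.span (Set.range fun a : {a : Fin (n + 2) // a ∉ Set.range e} =>
      tautVec F c hF a.1)).map (Scheme.ΓSpecIso (CommRingCat.of (ChartRing F c hF))).inv.hom)) := by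
    have h := (hρ.restrict U).comp_iso ee.symm
    rw [← Scheme.IdealSheafData.comap_comp, Iso.symm_inv, hee] at h
    exact WhitneyCubic.isBlowup_of_ideal_eq h (comap_chart_eq_ofIdealTop k F hF hd e he fk hfk' hfkC hfke hfk0 c)
  -- the stalk of `Z` at `z` is the stalk of the open piece `ρ⁻¹ U` at `⟨z, _⟩`
  haveI : IsIso ((ρ ⁻¹ᵁ U).ι.stalkMap ⟨z, hzU⟩) := inferInstance
  suffices hst : IsRegularLocalRing ((↑(ρ ⁻¹ᵁ U) : Scheme.{0}).presheaf.stalk ⟨z, hzU⟩) from by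
    haveI := hst
    exact IsRegularLocalRing.of_ringEquiv (asIso ((ρ ⁻¹ᵁ U).ι.stalkMap ⟨z, hzU⟩)).commRingCatIsoToRingEquiv.symm
  by_cases hce : c ∈ Set.range e
  · -- `c ∈ range e`: the charts at the generators are spectra of regular rings
    obtain ⟨j, φ, hφ, hzφ, -⟩ := IsBlowup.exists_chart_of_span_range_eq hρU
      (fun a : {a : Fin (n + 2) // a ∉ Set.range e} => tautVec F c hF a.1) rfl ⟨z, hzU⟩
    obtain ⟨w, hw⟩ := hzφ
    haveI := hon c hce j
    by_contra hz
    rw [← hw] at hz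
    exact not_isRegularLocalRing_localization_of_stalk φ w hz inferInstance
  · -- `c ∉ range e`: the centre is the unit ideal, the blow-up is an isomorphism onto the regular `Spec (ChartRing F c)`
    have htop : Ideal.span (Set.range fun a : {a : Fin (n + 2) // a ∉ Set.range e} => tautVec F c hF a.1) = ⊤ :=
      Ideal.eq_top_of_isUnit_mem _ (Ideal.subset_span ⟨⟨c, hce⟩, rfl⟩)
        (by rw [show (fun a : {a : Fin (n + 2) // a ∉ Set.range e} => tautVec F c hF a.1) ⟨c, hce⟩ = tautVec F c hF c from rfl,
          tautVec_self]; exact isUnit_one)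
    have hI : ofIdealTop ((Ideal.span (Set.range fun a : {a : Fin (n + 2) // a ∉ Set.range e} => tautVec F c hF a.1)).map
        (Scheme.ΓSpecIso (CommRingCat.of (ChartRing F c hF))).inv.hom) = ⊤ := by
      rw [htop, Ideal.map_top]
      exact Scheme.IdealSheafData.ext_of_isAffine (by rw [ideal_ofIdealTop_top]; rfl)
    have hρU' : IsBlowup ((ρ ∣_ U) ≫ ee.symm.hom) (⊤ : (Spec (CommRingCat.of (ChartRing F c hF))).IdealSheafData) := by
      rw [← hI]
      exact hρU
    haveI : IsIso ((ρ ∣_ U) ≫ ee.symm.hom) := hρU'.isIso isEffectiveCartier_top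
    haveI : IsRegularRing (ChartRing F c hF) := hoff c hce
    haveI : IsRegularLocalRing ((Spec (CommRingCat.of (ChartRing F c hF))).presheaf.stalk (((ρ ∣_ U) ≫ ee.symm.hom) ⟨z, hzU⟩)) :=
      Scheme.isRegular_Spec (CommRingCat.of (ChartRing F c hF)) (((ρ ∣_ U) ≫ ee.symm.hom) ⟨z, hzU⟩)
    exact IsRegularLocalRing.of_ringEquiv
      (R := (Spec (CommRingCat.of (ChartRing F c hF))).presheaf.stalk (((ρ ∣_ U) ≫ ee.symm.hom) ⟨z, hzU⟩))
      (asIso (((ρ ∣_ U) ≫ ee.symm.hom).stalkMap ⟨z, hzU⟩)).commRingCatIsoToRingEquiv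

end Centre

end HypersurfaceSpecimen

/-! ## The linear-centre rung for an arbitrary set of killed variables -/

/-- **THE LINEAR-CENTRE RUNG FOR EL♮, ARBITRARY KILLED VARIABLES** (ambient `Fin (N + 1)`, surviving variables `e : Fin (r+1) ↪ Fin (N+1)`):
`H ⊆ ℙᴺ_K` integral, `Λ = ker Proj(f_K)` the ideal sheaf of the coordinate `ℙʳ = V(x_a : a ∉ range e)`; if `supp Λ ⊆ ι(H)`, `ι(H) ⊄ supp Λ`
and every blow-up of `H` along `Λ·𝒪_H` is regular, then `ELNatAt p K N H ι` — one horizontal E1 step over `𝕎(K)` with centre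
`ker Proj(f_O) ≅ ℙʳ_O`, regular (`LinearCentre.isRegular_kerSubscheme`) and `O`-flat (`LinearCentre.flat_kerSubschemeι_comp`), whose special
fibre is `Λ` (`LinearCentre.ker_projMap_kill_eq_comap`); packaged by `elNatAt_of_oneStep₀` (p505461). The last-`m`-variables case is
`elNatAt_of_linearCentre` (p529556). [OURS · L1 W4.5b] [folklore] -/
theorem elNatAt_of_linearCentreKill (p : ℕ) (hp : p.Prime) (K : Type) [Field K] [CharP K p] [IsAlgClosed K] {N r : ℕ}
    (e : Fin (r + 1) → Fin (N + 1)) (he : Function.Injective e)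
    (H : Scheme.{0}) (ι : H ⟶ (projectiveSpace N K).left) [IsClosedImmersion ι] [IsIntegral H]
    (fk : homogeneousSubmodule (Fin (N + 1)) K →+*ᵍ homogeneousSubmodule (Fin (r + 1)) K)
    (hfk' : HomogeneousIdeal.irrelevant (homogeneousSubmodule (Fin (r + 1)) K) ≤
      (HomogeneousIdeal.irrelevant (homogeneousSubmodule (Fin (N + 1)) K)).map fk)
    (hfkC : ∀ a : K, fk (C a) = C a) (hfke : ∀ j : Fin (r + 1), fk (X (e j)) = X j)
    (hfk0 : ∀ i : Fin (N + 1), i ∉ Set.range e → fk (X i) = 0)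
    (hsupp : ((Proj.map fk hfk').ker.support : Set (Proj (homogeneousSubmodule (Fin (N + 1)) K))) ⊆ Set.range ι)
    (hgen : ¬ (Set.range ι ⊆ ((Proj.map fk hfk').ker.support : Set (Proj (homogeneousSubmodule (Fin (N + 1)) K)))))
    (hdown : ∀ (Z : Scheme.{0}) (ρ : Z ⟶ H), IsBlowup ρ ((Proj.map fk hfk').ker.comap ι) → Scheme.IsRegular Z) :
    Theorems.EquisingularLift.ELNatAt p K N H ι := by
  classical
  obtain ⟨O, i1, i2, i3, i4, -, -, π, hπ⟩ := stub_wittRing p hp K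
  obtain ⟨fO, hfO', hfOC, hfOe, hfO0⟩ := LinearCentre.exists_kill (R := O) e he
  refine elNatAt_of_oneStep₀ K N H ι O π hπ (Proj.map fO hfO').ker
    (LinearCentre.isRegular_kerSubscheme e fO hfO' hfOC hfOe) (LinearCentre.flat_kerSubschemeι_comp e fO hfO' hfOC hfOe)
    (Proj.map fk hfk').ker ?_ hgen hsupp hdown
  intro φ hφ' hφ
  exact (LinearCentre.ker_projMap_kill_eq_comap π hπ e φ hφ hφ' fO hfO' hfOC hfOe hfO0 fk hfk' hfkC hfke hfk0).symm

end Summit.ResolutionOfSingularities.ResolutionOfSingularities.Cruxes.EquisingularLiftNat.Sections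

end
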